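import Mathlib.Data.Fin.Tuple.Basic
import Mathlib.Data.Fintype.Card
import Mathlib.Data.Fintype.Pi
import Mathlib.Logic.Equiv.Fin.Basic
import Literature.Computability.Cryptography.QuantumQuery
import Literature.Computability.Complexity.DecisionTree
import HarnessLib

/-!
# SINK-OF-VERIFIABLE-LINE as a black-box promise problem in the Boolean query model

The SINK-OF-VERIFIABLE-LINE problem (SVL) of Abbot–Kane–Valiant (T. Abbot, D. Kane, P. Valiant,
*On algorithms for Nash equilibria*, unpublished manuscript, 2004, where it carries no name) and
Bitansky–Paneth–Rosen [BitanskyPanethRosen2015, Def. 2.2, p. 6]: an instance `(S, V, x_s, T)`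
consists of a source `x_s ∈ {0,1}ⁿ`, a target index `T` and circuits `S : {0,1}ⁿ → {0,1}ⁿ`,
`V : {0,1}ⁿ × [T] → {0,1}` with the guarantee "`V(x, i) = 1` iff `x = xᵢ := S^{i-1}(x_s)`"; the
witness is the sink, the unique `w` with `V(w, T) = 1`.

This file gives the BLACK-BOX (query) version used by route `WhiteBoxWalk` of summit
`QuantumAdvantage` (crux `WbwVerifiableLineNoSpeedup`, which previously inlined these tables):
the circuits are replaced by their tables, presented to a Boolean query algorithm
(`Literature.Computability.Cryptography.QQueryAlg`, `Literature.Computability.Complexity.DecisionTree`)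
as one input string, exactly as Simon's problem is presented in `QueryComplexity.lean`
(`simonIndex`, `simonPromise`).

* Parameters: `m` (name length: vertex names are `{0,1}ᵐ`, numbered `x < 2ᵐ`, bit `j` of the
  name `x` being `Nat.testBit x j`) and `T` (the line has the `T + 1` vertices
  `x₀, x₁, …, x_T`, i.e. `T` successor steps).
* Input layout (`SVLInput m T = (Fin (2ᵐ·m + 2ᵐ·(T+1)) → Bool)`): first the S-table, bit `j` of
  `S(x)` at position `Fin.castAdd _ (finProdFinEquiv (x, j))` (`svlSuccIndex`, `svlSuccBit`,
  decoded name `svlSucc`), then the V-table, `V(x, i)` at position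
  `Fin.natAdd _ (finProdFinEquiv (x, i))` (`svlVerifyIndex`, `svlVerify`). The encoder of a pair
  of tables is `svlInput` (cf. `simonInput`).
* `IsSvlLine t xs`: `xs : Fin (T+1) → Fin (2ᵐ)` is a verifiable line of the input `t`: the `xs i`
  are pairwise distinct, `xs 0 = 0ᵐ`, `S(xs i) = xs (i+1)` for `i < T` (stated bitwise through
  `Nat.testBit`, equivalently `svlSucc t (xs i) = xs (i+1)`, `isSvlLine_iff`), and
  `V(x, i) = [x = xs i]` for all `x, i`. `S` is unconstrained off the line and at the sink.
* `svlPromise m T` — the promise set `{t | ∃ xs, IsSvlLine t xs}`; `svlSinkBit m T t` — the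
  Boolean function "the vertex `x` with `V(x, T) = 1` is odd" (the low-order bit of the sink's
  name). `svlPromise_eq` / `svlSinkBit_eq` identify them, by `rfl`, with the verbatim inline
  set and function of the crux `Summit.QuantumAdvantage.QuantumAdvantage.Theses.WhiteBoxWalk.
  WbwVerifiableLineNoSpeedup`, which therefore reads
  `∃ c > 0, ∀ m T, … → c · min (T+1) √(2ᵐ) / m ≤ quantumQueryComplexityOn (1/3) (svlPromise m T)
  (svlSinkBit m T)`.
* Sanity: the line is unique (`IsSvlLine.unique`), the sink bit is the parity of `xs T`
  (`IsSvlLine.svlSinkBit_eq`), the promise set is nonempty iff `T + 1 ≤ 2ᵐ`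
  (`svlPromise_nonempty_iff`; the straight line `0, 1, …, T`), and the classical upper bound
  by following the line: `detQueryComplexityOn (svlPromise m T) (svlSinkBit m T) ≤ m · T`
  (`detQueryComplexityOn_svlPromise_le`: read the `m` bits of `S(x₀)`, then of `S(x₁)`, …, output
  the parity of `x_T`; the classical `T`-step evaluation of an iterated black box,
  [Ozhigov1999, Summary and §2]), hence also `R_ε ≤ m · T`.

Differences from the printed Def. 2.2, all normalisations made by the requesting route and
recorded here rather than hidden: (i) the source is fixed to the name `0ᵐ` (BPR allow any `x_s`;
a relabelling); (ii) vertices are indexed `0, …, T` (BPR: `x₁ = x_s, …, x_T`, so BPR's target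
index corresponds to our `T + 1` vertices); (iii) the line is required to be simple
(`Function.Injective xs`) — automatic for BPR's hard instances, whose `i`-th vertex `(i, σᵢ)`
carries its index (§5.2), but not part of Def. 2.2 verbatim; (iv) BPR's SVL is a SEARCH problem,
here turned into the Boolean function "low-order bit of the sink" so that the query measures
`Q_ε`, `R_ε`, `D` of Buhrman–de Wolf apply. What is NOT here: any quantum lower bound (the crux
itself; Ozhigov's `Ω(T)` for `S` alone [Ozhigov1999, Thm. 1] is not vendored).

Mathlib has no query-complexity or TFNP material (searched `svl`, `VerifiableLine`, `EndOfLine`,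
`query`); we reuse `finProdFinEquiv`, `Fin.append`, `Nat.testBit`, `Equiv.ofBijective` and the
tree preludes `DecisionTree` / `QuantumQuery`.
-/

namespace Literature.Computability.QuantumComplexity

open Complexity Cryptography

section SVL

variable {m T : ℕ}

/-! ### Vertex names and their bits -/

/-- The `m` bits of a vertex name: names `{0,1}ᵐ` are numbered `x < 2ᵐ` and bit `j` of `x` is
`Nat.testBit x j` (low-order bit first). [folklore] -/
def svlBits (m : ℕ) (x : Fin (2 ^ m)) : Fin m → Bool := fun j => x.val.testBit j.val

/-- Bit `j` of the name `x` is `Nat.testBit x j`. [folklore] -/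
@[simp] theorem svlBits_apply (x : Fin (2 ^ m)) (j : Fin m) :
    svlBits m x j = x.val.testBit j.val := rfl

/-- A name `x < 2ᵐ` is determined by its `m` low-order bits. [folklore] -/
theorem svlBits_injective (m : ℕ) : Function.Injective (svlBits m) := by
  intro x y h
  apply Fin.ext
  apply Nat.eq_of_testBit_eq
  intro i
  by_cases hi : i < m
  · exact congrFun h ⟨i, hi⟩
  · have hle : 2 ^ m ≤ 2 ^ i := Nat.pow_le_pow_right (by norm_num) (Nat.le_of_not_lt hi)
    rw [Nat.testBit_lt_two_pow (lt_of_lt_of_le x.isLt hle),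
      Nat.testBit_lt_two_pow (lt_of_lt_of_le y.isLt hle)]

/-- Names `x < 2ᵐ` correspond bijectively to their bit vectors `{0,1}ᵐ` (binary expansion).
[folklore] -/
noncomputable def svlBitsEquiv (m : ℕ) : Fin (2 ^ m) ≃ (Fin m → Bool) :=
  Equiv.ofBijective (svlBits m)
    ((Fintype.bijective_iff_injective_and_card _).2 ⟨svlBits_injective m, by simp⟩)

/-- `svlBitsEquiv` is `svlBits`. [folklore] -/
@[simp] theorem svlBitsEquiv_apply (x : Fin (2 ^ m)) : svlBitsEquiv m x = svlBits m x := rfl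

/-- The name with prescribed bits has these bits. [folklore] -/
@[simp] theorem svlBits_symm_apply (bs : Fin m → Bool) :
    svlBits m ((svlBitsEquiv m).symm bs) = bs :=
  (svlBitsEquiv m).apply_symm_apply bs

/-! ### The input layout: S-table, then V-table -/

/-- The inputs of the black-box SVL problem with parameters `m, T`: Boolean strings of length
`2ᵐ · m + 2ᵐ · (T + 1)` (the table of `S : {0,1}ᵐ → {0,1}ᵐ` followed by the table of
`V : {0,1}ᵐ × {0, …, T} → {0,1}`). [cite: BitanskyPanethRosen2015, Def. 2.2 (p. 6), tables of the circuits S, V] -/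
abbrev SVLInput (m T : ℕ) : Type := Fin (2 ^ m * m + 2 ^ m * (T + 1)) → Bool

/-- Position of bit `j` of `S(x)` in the input: the S-table occupies the first `2ᵐ · m`
positions, the pair `(x, j)` being encoded by `finProdFinEquiv`. [cite: BitanskyPanethRosen2015, Def. 2.2 (p. 6), successor circuit S] -/
def svlSuccIndex (m T : ℕ) (x : Fin (2 ^ m)) (j : Fin m) : Fin (2 ^ m * m + 2 ^ m * (T + 1)) :=
  Fin.castAdd (2 ^ m * (T + 1)) (finProdFinEquiv (x, j))

/-- Position of the bit `V(x, i)` in the input: the V-table occupies the last `2ᵐ · (T + 1)`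
positions, the pair `(x, i)` being encoded by `finProdFinEquiv`. [cite: BitanskyPanethRosen2015, Def. 2.2 (p. 6), verifier circuit V] -/
def svlVerifyIndex (m T : ℕ) (x : Fin (2 ^ m)) (i : Fin (T + 1)) :
    Fin (2 ^ m * m + 2 ^ m * (T + 1)) :=
  Fin.natAdd (2 ^ m * m) (finProdFinEquiv (x, i))

/-- Bit `j` of the successor `S(x)`, read off the input `t`. [cite: BitanskyPanethRosen2015, Def. 2.2 (p. 6), successor circuit S] -/
def svlSuccBit (t : SVLInput m T) (x : Fin (2 ^ m)) (j : Fin m) : Bool :=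
  t (svlSuccIndex m T x j)

/-- The successor `S(x) ∈ {0,1}ᵐ` (a name `< 2ᵐ`), read off the input `t`. [cite: BitanskyPanethRosen2015, Def. 2.2 (p. 6), successor circuit S] -/
noncomputable def svlSucc (t : SVLInput m T) (x : Fin (2 ^ m)) : Fin (2 ^ m) :=
  (svlBitsEquiv m).symm (svlSuccBit t x)

/-- The verifier bit `V(x, i)`, read off the input `t`. [cite: BitanskyPanethRosen2015, Def. 2.2 (p. 6), verifier circuit V] -/
def svlVerify (t : SVLInput m T) (x : Fin (2 ^ m)) (i : Fin (T + 1)) : Bool :=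
  t (svlVerifyIndex m T x i)

/-! ### The promise and the Boolean function -/

/-- `IsSvlLine t xs`: `xs = (x₀, …, x_T)` is a verifiable line of the input `t = (S, V)`: the
vertices `xs i` are pairwise distinct, the source is `x₀ = 0ᵐ`, `S(xᵢ) = xᵢ₊₁` for `i < T`
(bitwise: bit `j` of the S-table row `xᵢ` is `Nat.testBit xᵢ₊₁ j`), and `V(x, i) = 1 ↔ x = xᵢ`
for all `x` and `i ≤ T`. `S` is unconstrained off the line and at the sink `x_T`. This is the
guarantee of [BitanskyPanethRosen2015, Def. 2.2] with the source normalised to `0ᵐ`, vertices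
indexed from `0`, and simplicity of the line made explicit (module docstring, (i)–(iii)). [cite: BitanskyPanethRosen2015, Def. 2.2 (p. 6)] -/
def IsSvlLine (t : SVLInput m T) (xs : Fin (T + 1) → Fin (2 ^ m)) : Prop :=
  Function.Injective xs ∧ (xs 0).val = 0 ∧
    (∀ i : Fin T, ∀ j : Fin m, svlSuccBit t (xs i.castSucc) j = (xs i.succ).val.testBit j.val) ∧
      ∀ x : Fin (2 ^ m), ∀ i : Fin (T + 1), svlVerify t x i = decide (x = xs i)

/-- The promise set of the black-box SINK-OF-VERIFIABLE-LINE problem with parameters `m, T`: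
the inputs `t = (S, V)` admitting a verifiable line `x₀ = 0ᵐ, x₁, …, x_T`. [cite: BitanskyPanethRosen2015, Def. 2.2 (p. 6)] -/
def svlPromise (m T : ℕ) : Set (SVLInput m T) :=
  {t | ∃ xs : Fin (T + 1) → Fin (2 ^ m), IsSvlLine t xs}

/-- The Boolean SINK-OF-VERIFIABLE-LINE function: `true` iff some odd name `x` (low-order bit
`1`) has `V(x, T) = 1`; on the promise set this is the low-order bit of the sink `x_T`, the
unique witness of the search problem (`IsSvlLine.svlSinkBit_eq`). Decision version chosen by
route `WhiteBoxWalk` of the search problem of [BitanskyPanethRosen2015, Def. 2.2] ("a string `w`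
is a valid witness iff `V(w, T) = 1`"). [cite: BitanskyPanethRosen2015, Def. 2.2 (p. 6), witness] -/
def svlSinkBit (m T : ℕ) (t : SVLInput m T) : Bool :=
  decide (∃ x : Fin (2 ^ m), svlVerify t x (Fin.last T) = true ∧ x.val % 2 = 1)

/-- Unfolding lemma: `svlPromise m T` is, by `rfl`, the set written inline in the crux
`WbwVerifiableLineNoSpeedup` of route `QuantumAdvantage/WhiteBoxWalk`. [cite: BitanskyPanethRosen2015, Def. 2.2 (p. 6)] -/
theorem svlPromise_eq (m T : ℕ) :
    svlPromise m T =
      {t : Fin (2 ^ m * m + 2 ^ m * (T + 1)) → Bool | ∃ xs : Fin (T + 1) → Fin (2 ^ m),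
        Function.Injective xs ∧ (xs 0).val = 0 ∧
          (∀ i : Fin T, ∀ j : Fin m,
              t (Fin.castAdd (2 ^ m * (T + 1)) (finProdFinEquiv (xs i.castSucc, j))) =
                (xs i.succ).val.testBit j.val) ∧
            ∀ x : Fin (2 ^ m), ∀ i : Fin (T + 1),
              t (Fin.natAdd (2 ^ m * m) (finProdFinEquiv (x, i))) = decide (x = xs i)} :=
  rfl

/-- Unfolding lemma: `svlSinkBit m T` is, by `rfl`, the function written inline in the crux
`WbwVerifiableLineNoSpeedup` of route `QuantumAdvantage/WhiteBoxWalk`. [cite: BitanskyPanethRosen2015, Def. 2.2 (p. 6), witness] -/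
theorem svlSinkBit_eq (m T : ℕ) :
    svlSinkBit m T = fun t =>
      decide (∃ x : Fin (2 ^ m),
        t (Fin.natAdd (2 ^ m * m) (finProdFinEquiv (x, Fin.last T))) = true ∧ x.val % 2 = 1) :=
  rfl

/-- Membership in the promise set is the existence of a verifiable line. [cite: BitanskyPanethRosen2015, Def. 2.2 (p. 6)] -/
theorem mem_svlPromise_iff {t : SVLInput m T} :
    t ∈ svlPromise m T ↔ ∃ xs : Fin (T + 1) → Fin (2 ^ m), IsSvlLine t xs :=
  Iff.rfl

/-- The bitwise successor condition says `S(x) = y`. [folklore] -/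
theorem svlSuccBit_eq_testBit_iff {t : SVLInput m T} {x y : Fin (2 ^ m)} :
    (∀ j : Fin m, svlSuccBit t x j = y.val.testBit j.val) ↔ svlSucc t x = y := by
  rw [svlSucc, Equiv.symm_apply_eq, svlBitsEquiv_apply]
  exact ⟨fun h => funext h, fun h j => congrFun h j⟩

/-- `IsSvlLine` with the successor condition in the form `S(xᵢ) = xᵢ₊₁`. [cite: BitanskyPanethRosen2015, Def. 2.2 (p. 6)] -/
theorem isSvlLine_iff {t : SVLInput m T} {xs : Fin (T + 1) → Fin (2 ^ m)} :
    IsSvlLine t xs ↔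
      Function.Injective xs ∧ (xs 0).val = 0 ∧
        (∀ i : Fin T, svlSucc t (xs i.castSucc) = xs i.succ) ∧
          ∀ x : Fin (2 ^ m), ∀ i : Fin (T + 1), svlVerify t x i = decide (x = xs i) := by
  unfold IsSvlLine
  exact and_congr_right' (and_congr_right'
    (and_congr_left' (forall_congr' fun _ => svlSuccBit_eq_testBit_iff)))

namespace IsSvlLine

variable {t : SVLInput m T} {xs ys : Fin (T + 1) → Fin (2 ^ m)}

/-- The vertices of a verifiable line are pairwise distinct. [cite: BitanskyPanethRosen2015, Def. 2.2 (p. 6)] -/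
theorem injective (h : IsSvlLine t xs) : Function.Injective xs := h.1

/-- The source of a verifiable line is `0ᵐ`. [cite: BitanskyPanethRosen2015, Def. 2.2 (p. 6), source] -/
theorem source (h : IsSvlLine t xs) : (xs 0).val = 0 := h.2.1

/-- Along a verifiable line, `S(xᵢ) = xᵢ₊₁`. [cite: BitanskyPanethRosen2015, Def. 2.2 (p. 6), xᵢ = S(xᵢ₋₁)] -/
theorem svlSucc_eq (h : IsSvlLine t xs) (i : Fin T) : svlSucc t (xs i.castSucc) = xs i.succ :=
  svlSuccBit_eq_testBit_iff.1 (h.2.2.1 i)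

/-- The verifier accepts `(x, i)` iff `x` is the `i`-th vertex. [cite: BitanskyPanethRosen2015, Def. 2.2 (p. 6), V(x, i) = 1 iff x = xᵢ] -/
theorem svlVerify_eq_true_iff (h : IsSvlLine t xs) {x : Fin (2 ^ m)} {i : Fin (T + 1)} :
    svlVerify t x i = true ↔ x = xs i := by
  rw [h.2.2.2 x i, decide_eq_true_iff]

/-- The verifiable line of an input is unique (it is read off `V`). [cite: BitanskyPanethRosen2015, §2.2 (p. 6), "every valid SVL instance has a single witness"] -/
theorem unique (hx : IsSvlLine t xs) (hy : IsSvlLine t ys) : xs = ys :=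
  funext fun _ => hy.svlVerify_eq_true_iff.1 (hx.svlVerify_eq_true_iff.2 rfl)

/-- The sink `x_T` is the unique `w` with `V(w, T) = 1`. [cite: BitanskyPanethRosen2015, Def. 2.2 (p. 6), witness] -/
theorem svlVerify_last_eq_true_iff (h : IsSvlLine t xs) {w : Fin (2 ^ m)} :
    svlVerify t w (Fin.last T) = true ↔ w = xs (Fin.last T) :=
  h.svlVerify_eq_true_iff

/-- On the promise set the SVL bit is the low-order bit of the sink `x_T`. [cite: BitanskyPanethRosen2015, Def. 2.2 (p. 6), witness] -/
theorem svlSinkBit_eq (h : IsSvlLine t xs) :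
    svlSinkBit m T t = decide ((xs (Fin.last T)).val % 2 = 1) := by
  unfold svlSinkBit
  rw [decide_eq_decide]
  simp only [h.svlVerify_eq_true_iff, exists_eq_left]

end IsSvlLine

/-! ### Encoding a pair of tables; (non)emptiness of the promise -/

/-- The input string of the pair of tables `S : {0,1}ᵐ → {0,1}ᵐ`, `V : {0,1}ᵐ × {0,…,T} → {0,1}`
(S-table then V-table, cf. `simonInput`). [cite: BitanskyPanethRosen2015, Def. 2.2 (p. 6), instance (S, V, x_s, T)] -/
def svlInput (m T : ℕ) (S : Fin (2 ^ m) → Fin (2 ^ m)) (V : Fin (2 ^ m) → Fin (T + 1) → Bool) :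
    SVLInput m T :=
  Fin.append (fun k => svlBits m (S (finProdFinEquiv.symm k).1) (finProdFinEquiv.symm k).2)
    fun k => V (finProdFinEquiv.symm k).1 (finProdFinEquiv.symm k).2

/-- Reading the S-table of `svlInput m T S V` gives the bits of `S`. [folklore] -/
@[simp] theorem svlSuccBit_svlInput (S : Fin (2 ^ m) → Fin (2 ^ m))
    (V : Fin (2 ^ m) → Fin (T + 1) → Bool) (x : Fin (2 ^ m)) (j : Fin m) :
    svlSuccBit (svlInput m T S V) x j = (S x).val.testBit j.val := by
  simp only [svlSuccBit, svlSuccIndex, svlInput, Fin.append_left, Equiv.symm_apply_apply,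
    svlBits_apply]

/-- Reading the V-table of `svlInput m T S V` gives `V`. [folklore] -/
@[simp] theorem svlVerify_svlInput (S : Fin (2 ^ m) → Fin (2 ^ m))
    (V : Fin (2 ^ m) → Fin (T + 1) → Bool) (x : Fin (2 ^ m)) (i : Fin (T + 1)) :
    svlVerify (svlInput m T S V) x i = V x i := by
  simp only [svlVerify, svlVerifyIndex, svlInput, Fin.append_right, Equiv.symm_apply_apply]

/-- The decoded successor of `svlInput m T S V` is `S`. [folklore] -/
@[simp] theorem svlSucc_svlInput (S : Fin (2 ^ m) → Fin (2 ^ m))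
    (V : Fin (2 ^ m) → Fin (T + 1) → Bool) (x : Fin (2 ^ m)) :
    svlSucc (svlInput m T S V) x = S x :=
  svlSuccBit_eq_testBit_iff.1 fun j => svlSuccBit_svlInput S V x j

/-- The tables `(S, V)` satisfy the promise iff there is a simple line `x₀ = 0ᵐ, …, x_T` with
`S(xᵢ) = xᵢ₊₁` (`i < T`) and `V(x, i) = [x = xᵢ]`: the guarantee of Def. 2.2 read on functions
rather than tables. [cite: BitanskyPanethRosen2015, Def. 2.2 (p. 6)] -/
theorem svlInput_mem_svlPromise_iff (S : Fin (2 ^ m) → Fin (2 ^ m))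
    (V : Fin (2 ^ m) → Fin (T + 1) → Bool) :
    svlInput m T S V ∈ svlPromise m T ↔
      ∃ xs : Fin (T + 1) → Fin (2 ^ m), Function.Injective xs ∧ (xs 0).val = 0 ∧
        (∀ i : Fin T, S (xs i.castSucc) = xs i.succ) ∧
          ∀ x : Fin (2 ^ m), ∀ i : Fin (T + 1), V x i = decide (x = xs i) := by
  simp only [mem_svlPromise_iff, isSvlLine_iff, svlSucc_svlInput, svlVerify_svlInput]

/-- The straight line `0, 1, …, T` in `{0,1}ᵐ` (requires `T + 1 ≤ 2ᵐ`). [folklore] -/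
def svlStraightLine (h : T + 1 ≤ 2 ^ m) (i : Fin (T + 1)) : Fin (2 ^ m) :=
  ⟨i.val, lt_of_lt_of_le i.isLt h⟩

/-- The instance `S(x) = x + 1 (mod 2ᵐ)`, `V(x, i) = [x = i]` satisfies the promise, with line
`0, 1, …, T`, as soon as `T + 1 ≤ 2ᵐ`. [folklore] -/
theorem svlInput_straight_mem_svlPromise (h : T + 1 ≤ 2 ^ m) :
    svlInput m T (fun x => ⟨(x.val + 1) % 2 ^ m, Nat.mod_lt _ (Nat.two_pow_pos m)⟩)
        (fun x i => decide (x.val = i.val)) ∈ svlPromise m T := by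
  rw [svlInput_mem_svlPromise_iff]
  refine ⟨svlStraightLine h, fun i j hij => Fin.ext (Fin.mk.inj_iff.1 hij), rfl, fun i => ?_,
    fun x i => ?_⟩
  · apply Fin.ext
    simp only [svlStraightLine, Fin.val_castSucc, Fin.val_succ]
    exact Nat.mod_eq_of_lt (by omega)
  · simp [svlStraightLine, Fin.ext_iff]

/-- The promise set is nonempty as soon as `T + 1 ≤ 2ᵐ` (there is room for `T + 1` distinct
names). [folklore] -/
theorem svlPromise_nonempty (h : T + 1 ≤ 2 ^ m) : (svlPromise m T).Nonempty :=
  ⟨_, svlInput_straight_mem_svlPromise h⟩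

/-- If `2ᵐ < T + 1` there is no simple line with `T + 1` vertices: the promise set is empty
(degenerate parameters). [folklore] -/
theorem svlPromise_eq_empty (h : 2 ^ m < T + 1) : svlPromise m T = ∅ := by
  ext t
  simp only [mem_svlPromise_iff, Set.mem_empty_iff_false, iff_false, not_exists]
  intro xs hxs
  have hcard := Fintype.card_le_of_injective xs hxs.injective
  simp only [Fintype.card_fin] at hcard
  omega

/-- The promise set is nonempty iff `T + 1 ≤ 2ᵐ`. [folklore] -/
theorem svlPromise_nonempty_iff : (svlPromise m T).Nonempty ↔ T + 1 ≤ 2 ^ m := by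
  refine ⟨fun h => ?_, svlPromise_nonempty⟩
  by_contra hlt
  rw [svlPromise_eq_empty (Nat.lt_of_not_le hlt)] at h
  exact Set.not_nonempty_empty h

/-! ### The classical upper bound: follow the line -/

/-- The decision tree that reads the input bits at positions `pos 0, …, pos (k-1)` (in this
order) and continues with the tree `f bs` selected by the answers `bs`. [folklore] -/
def svlRead {N : ℕ} : (k : ℕ) → (Fin k → Fin N) → ((Fin k → Bool) → DecisionTree N) →
    DecisionTree N
  | 0, _, f => f Fin.elim0
  | k + 1, pos, f =>
      .query (pos 0) (svlRead k (fun i => pos i.succ) fun bs => f (Fin.cons false bs))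
        (svlRead k (fun i => pos i.succ) fun bs => f (Fin.cons true bs))

/-- `svlRead k pos f` evaluates as the continuation fed with the bits read. [folklore] -/
theorem eval_svlRead {N : ℕ} (x : Fin N → Bool) :
    ∀ (k : ℕ) (pos : Fin k → Fin N) (f : (Fin k → Bool) → DecisionTree N),
      (svlRead k pos f).eval x = (f fun i => x (pos i)).eval x
  | 0, pos, f => by
      rw [svlRead]
      congr
      funext i
      exact i.elim0
  | k + 1, pos, f => by
      have key : ∀ b, x (pos 0) = b →
          (Fin.cons b (fun i => x (pos i.succ)) : Fin (k + 1) → Bool) = fun i => x (pos i) := by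
        rintro b rfl
        exact Fin.cons_self_tail (fun i => x (pos i))
      rw [svlRead, DecisionTree.eval_query, eval_svlRead x k, eval_svlRead x k]
      cases h : x (pos 0)
      · rw [key false h]
        simp
      · rw [key true h]
        simp

/-- `svlRead k pos f` has depth at most `k` plus the depth of the continuations. [folklore] -/
theorem depth_svlRead_le {N d : ℕ} :
    ∀ (k : ℕ) (pos : Fin k → Fin N) (f : (Fin k → Bool) → DecisionTree N),
      (∀ bs, (f bs).depth ≤ d) → (svlRead k pos f).depth ≤ k + d
  | 0, pos, f, hf => by simpa [svlRead] using hf _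
  | k + 1, pos, f, hf => by
      have h0 := depth_svlRead_le k (fun i => pos i.succ) (fun bs => f (Fin.cons false bs))
        fun _ => hf _
      have h1 := depth_svlRead_le k (fun i => pos i.succ) (fun bs => f (Fin.cons true bs))
        fun _ => hf _
      simp only [svlRead, DecisionTree.depth_query]
      omega

/-- Follow the line for `s` more steps from the vertex `x` (each step reads the `m` bits of
`S(x)`), then output the low-order bit of the vertex reached: the classical step-by-step
evaluation of an iterated black box. [cite: Ozhigov1999, Summary and §2 (T sequential applications of the black box)] -/
noncomputable def svlFollow (m T : ℕ) : ℕ → Fin (2 ^ m) → DecisionTree (2 ^ m * m + 2 ^ m * (T + 1))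
  | 0, x => .leaf (decide (x.val % 2 = 1))
  | s + 1, x => svlRead m (svlSuccIndex m T x) fun bs => svlFollow m T s ((svlBitsEquiv m).symm bs)

/-- Following the line for `s` steps costs at most `m · s` Boolean queries. [cite: Ozhigov1999, Summary (time T for T sequential applications)] -/
theorem depth_svlFollow_le (m T : ℕ) :
    ∀ (s : ℕ) (x : Fin (2 ^ m)), (svlFollow m T s x).depth ≤ m * s
  | 0, x => by simp [svlFollow]
  | s + 1, x => by
      have hm : m * (s + 1) = m * s + m := Nat.mul_succ m s
      have := depth_svlRead_le (d := m * s) m (svlSuccIndex m T x)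
        (fun bs => svlFollow m T s ((svlBitsEquiv m).symm bs)) fun _ => depth_svlFollow_le m T s _
      rw [svlFollow]
      omega

/-- On an input with verifiable line `xs`, following the line for `s` steps from `xᵢ` with
`i + s = T` outputs the low-order bit of the sink `x_T`. [cite: Ozhigov1999, §2 (X_{s+1} = f(X_s))] -/
theorem IsSvlLine.eval_svlFollow {t : SVLInput m T} {xs : Fin (T + 1) → Fin (2 ^ m)}
    (h : IsSvlLine t xs) :
    ∀ (s : ℕ) (i : Fin (T + 1)), i.val + s = T →
      (svlFollow m T s (xs i)).eval t = decide ((xs (Fin.last T)).val % 2 = 1)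
  | 0, i, hi => by
      have hlast : i = Fin.last T := Fin.ext (by simpa using hi)
      subst hlast
      simp [svlFollow]
  | s + 1, i, hi => by
      have hlt : i.val < T := by omega
      have h1 : xs i = xs (Fin.castSucc ⟨i.val, hlt⟩) := congrArg xs (Fin.ext rfl)
      have h2 : (svlBitsEquiv m).symm (fun j => t (svlSuccIndex m T (xs i) j)) =
          xs (Fin.succ ⟨i.val, hlt⟩) := by
        rw [Equiv.symm_apply_eq]
        funext j
        rw [h1]
        exact h.2.2.1 ⟨i.val, hlt⟩ j
      rw [svlFollow, eval_svlRead, h2]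
      exact IsSvlLine.eval_svlFollow h s _ (by simp; omega)

/-- The line-following decision tree: start at the source `x₀ = 0ᵐ`, read `S` `T` times,
output the low-order bit of `x_T`. [cite: Ozhigov1999, Summary and §2] -/
noncomputable def svlLineTree (m T : ℕ) : DecisionTree (2 ^ m * m + 2 ^ m * (T + 1)) :=
  svlFollow m T T ⟨0, Nat.two_pow_pos m⟩

/-- The line-following tree has depth at most `m · T`. [cite: Ozhigov1999, Summary] -/
theorem depth_svlLineTree_le (m T : ℕ) : (svlLineTree m T).depth ≤ m * T :=
  depth_svlFollow_le m T T _

/-- The line-following tree computes the SVL bit on the promise set. [cite: Ozhigov1999, Summary and §2] -/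
theorem svlLineTree_computesOn (m T : ℕ) :
    (svlLineTree m T).ComputesOn (svlPromise m T) (svlSinkBit m T) := by
  rintro t ⟨xs, h⟩
  have h0 : (⟨0, Nat.two_pow_pos m⟩ : Fin (2 ^ m)) = xs 0 := Fin.ext h.source.symm
  rw [svlLineTree, h0, h.eval_svlFollow T 0 (by simp), h.svlSinkBit_eq]

/-- **Classical upper bound.** The deterministic query complexity of black-box SVL is at most
`m · T`: follow the line (`T` successor evaluations of `m` bits each; the parity of `x_T` needs no
query to `V`). [cite: Ozhigov1999, Summary ("we can compute T sequential applications of f … in time T")] -/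
theorem detQueryComplexityOn_svlPromise_le (m T : ℕ) :
    detQueryComplexityOn (svlPromise m T) (svlSinkBit m T) ≤ m * T :=
  (detQueryComplexityOn_le_depth _ (svlLineTree_computesOn m T)).trans (depth_svlLineTree_le m T)

/-- The weaker form `D ≤ m · (T + 1)` of the classical upper bound (one block of `m` queries per
vertex of the line). [cite: Ozhigov1999, Summary] -/
theorem detQueryComplexityOn_svlPromise_le_mul_succ (m T : ℕ) :
    detQueryComplexityOn (svlPromise m T) (svlSinkBit m T) ≤ m * (T + 1) :=
  (detQueryComplexityOn_svlPromise_le m T).trans (Nat.mul_le_mul_left m (Nat.le_succ T))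

/-- Hence the randomized query complexity of black-box SVL is at most `m · T` for every error
`ε ≥ 0`. [cite: Wolf2002, §2.2 (R_ε ≤ D)] -/
theorem randQueryComplexityOn_svlPromise_le (m T : ℕ) {ε : ℝ} (hε : 0 ≤ ε) :
    randQueryComplexityOn ε (svlPromise m T) (svlSinkBit m T) ≤ m * T :=
  (randQueryComplexityOn_le_det hε _ _).trans (detQueryComplexityOn_svlPromise_le m T)

end SVL

end Literature.Computability.QuantumComplexity
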